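import Summits.KontsevichZagierPeriods.KontsevichZagierPeriods.Theses.LinRedNormalForm
import Literature.NumberTheory.Transcendental.BrownZagierFormulaProofs
import Literature.NumberTheory.Transcendental.PeriodsWave0BallRivoalProofs
import Literature.NumberTheory.Transcendental.MultipleZetaValuesBridgeProofs
import Mathlib.LinearAlgebra.FiniteDimensional.Basic
import Mathlib.LinearAlgebra.Dimension.Constructions
import Mathlib.Order.Filter.AtTopBot.Archimedean
import Mathlib.Data.Set.Finite.Lattice

/-!
# Crux `HoffmanIndependence` (stmt-KontsevichZagierPeriods-15045), line `weight_split` —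
# stub `stub_oddWeights_finrank_ge`: UNCONDITIONAL growth of the odd-weight Hoffman spans

The load-bearing stub `stub_weightGrading : iSupIndep hoffmanSpan` of the line (Goncharov's grading
conjecture on the Hoffman weight spans `hoffmanSpan k = ℚ⟨ζ(u) : u ∈ {2,3}^×, |u| = k⟩ ⊆ ℝ`, open)
predicts, together with the in-weight stub, that the odd-weight filtered span
`W_a := hoffmanSpan 0 ⊔ ⨆_{odd k ≤ a} hoffmanSpan k` has dimension exactly `1 + ∑_{odd k ≤ a} d_k`
(`d_k` Zagier's numbers), growing exponentially in `a`. This file lands the strongest UNCONDITIONAL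
fragment of that prediction the tree can reach:

* `stub_oddWeights_finrank_ge` (the registered stub, by name and signature): for every `ε > 0`,
  eventually in `a`, `dim_ℚ W_a ≥ (1 - ε) log a / (1 + log 2)`.

Proof: `1 = ζ(∅) ∈ hoffmanSpan 0` (`multipleZeta_nil`; `∅` is the Hoffman word of weight `0`) and,
for odd `k = 2n + 1 ≥ 3`, `zetaValue k = ζ(k) ∈ hoffmanSpan k` (`multipleZeta_singleton_eq_zetaValue_of_ne_zero`
and Brown's level-one theorem `multipleZeta_odd_mem_hoffmanSpan`, proved in the tree from Zagier's
`2-3-2` evaluation and the `2`-adic Lemma 7.1 — no motives), so the Ball–Rivoal span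
`ℚ⟨1, ζ(3), ζ(5), …, ζ(a')⟩` is a subspace of `W_a` (`ballRivoalSpan_le_oddWeights`); `W_a` is
finite-dimensional (finitely many Hoffman words of each weight), so `finrank` is monotone, and the
Ball–Rivoal theorem `ball_rivoal_holds` (proved in the tree) bounds the smaller dimension from below.

Riders (same hypotheses, i.e. none):
* `oddWeights_finrank_tendsto_atTop` — `dim_ℚ W_a → ∞`;
* `oddWeights_not_le_infinite` — infinitely many odd weights `k` contribute NEW dimensions:
  `hoffmanSpan k ⊄ hoffmanSpan 0 ⊔ ⨆_{odd j < k} hoffmanSpan j` for infinitely many odd `k` (were the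
  set of such `k` bounded by `K`, every `W_a` would lie in `W_K`, contradicting the previous rider).

What is NOT here, and why. The grading stub predicts `dim_ℚ W_a = 1 + ∑_{odd k ≤ a} d_k`; the bound
proved here is logarithmic. Lindemann (`π` transcendental), which settles the even-weight rungs
`{0, 2, 4, …}` of the grading, says nothing in odd weights; and for any two SPECIFIC odd weights
nothing is known — e.g. `hoffmanSpan 5 ⊄ hoffmanSpan 0 ⊔ hoffmanSpan 3` contains `ζ(5)/ζ(3) ∉ ℚ`,
open; even `ζ(5) ∉ ℚ` is open (Zudilin: one of `ζ(5), ζ(7), ζ(9), ζ(11)` is irrational). The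
second rider is the honest form of "infinitely many odd weights are new": it does not say which.

No new definitions; this file supports the item, it does not close it.
[cite: BallRivoal2001, Théorème 1] [cite: Brown2012, Theorems 7.3 and 7.4]
-/

noncomputable section

namespace Summit.KontsevichZagierPeriods.LinRedNormalForm.HoffmanIndependence

open Literature.NumberTheory.Transcendental MZV Filter

/-! ## Bookkeeping: finite-dimensionality and the two membership facts -/

/-- Each Hoffman weight span `hoffmanSpan k` is finite-dimensional over `ℚ` (it lies in the weight
space `𝒵_k`, spanned by the finitely many MZVs of admissible indices of weight `k`). [folklore] -/
theorem finiteDimensional_hoffmanSpan (k : ℕ) : FiniteDimensional ℚ (hoffmanSpan k) :=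
  Submodule.finiteDimensional_of_le (hoffmanSpan_le_mzvSpace k)

/-- The odd-weight filtered span `W_a = hoffmanSpan 0 ⊔ ⨆_{odd k ≤ a} hoffmanSpan k` is
finite-dimensional over `ℚ` (a finite supremum of finite-dimensional subspaces). [folklore] -/
theorem finiteDimensional_oddWeights (a : ℕ) :
    FiniteDimensional ℚ
      ↥(hoffmanSpan 0 ⊔ ⨆ k ∈ (Finset.range (a + 1)).filter Odd, hoffmanSpan k) := by
  haveI : ∀ k, FiniteDimensional ℚ (hoffmanSpan k) := finiteDimensional_hoffmanSpan
  rw [← Finset.sup_eq_iSup]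
  infer_instance

/-- `1 = ζ(∅) ∈ hoffmanSpan 0`: the empty word is the Hoffman word of weight `0` and
`multipleZeta [] = 1`. [folklore] -/
theorem one_mem_hoffmanSpan_zero : (1 : ℝ) ∈ hoffmanSpan 0 :=
  Submodule.subset_span ⟨[], fun _ h => by simp at h, rfl, multipleZeta_nil.symm⟩

/-- **Odd zeta values are Hoffman combinations of their own weight**: for odd `k ≥ 3`,
`zetaValue k = ζ(k) ∈ hoffmanSpan k` (Brown 2012, Theorem 1.1 in depth one, proved in the tree
without motives: Zagier's theorem + the `2`-adic Lemma 7.1, `multipleZeta_odd_mem_hoffmanSpan`;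
and `multipleZeta [k] = zetaValue k`). [cite: Brown2012, Theorems 7.3 and 7.4] -/
theorem zetaValue_mem_hoffmanSpan {k : ℕ} (hk : Odd k) (h3 : 3 ≤ k) :
    zetaValue k ∈ hoffmanSpan k := by
  obtain ⟨n, rfl⟩ := hk
  rw [← multipleZeta_singleton_eq_zetaValue_of_ne_zero (by omega)]
  exact multipleZeta_odd_mem_hoffmanSpan n (by omega)

/-- **The Ball–Rivoal span sits inside the odd-weight filtered Hoffman span**:
`ℚ⟨1, ζ(3), ζ(5), …, ζ(a')⟩ ≤ hoffmanSpan 0 ⊔ ⨆_{odd k ≤ a} hoffmanSpan k` (`1 ∈ hoffmanSpan 0`,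
`ζ(k) ∈ hoffmanSpan k` for odd `3 ≤ k ≤ a`). [cite: Brown2012, Theorems 7.3 and 7.4] -/
theorem ballRivoalSpan_le_oddWeights (a : ℕ) :
    Submodule.span ℚ (insert (1 : ℝ) {x | ∃ k : ℕ, Odd k ∧ 3 ≤ k ∧ k ≤ a ∧ x = zetaValue k}) ≤
      hoffmanSpan 0 ⊔ ⨆ k ∈ (Finset.range (a + 1)).filter Odd, hoffmanSpan k := by
  refine Submodule.span_le.2 (Set.insert_subset_iff.2 ⟨?_, ?_⟩)
  · exact Submodule.mem_sup_left one_mem_hoffmanSpan_zero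
  · rintro x ⟨k, hk, h3, hka, rfl⟩
    refine Submodule.mem_sup_right ?_
    have hmem : k ∈ (Finset.range (a + 1)).filter Odd :=
      Finset.mem_filter.2 ⟨Finset.mem_range.2 (Nat.lt_succ_of_le hka), hk⟩
    exact (le_biSup hoffmanSpan hmem) (zetaValue_mem_hoffmanSpan hk h3)

/-! ## The registered stub -/

/-- **STUB `stub_oddWeights_finrank_ge` — UNCONDITIONAL odd-weight growth** (Ball–Rivoal fragment of
the grading stub `stub_weightGrading`). For every `ε > 0` and all sufficiently large `a`,
`dim_ℚ (hoffmanSpan 0 ⊔ ⨆_{odd k ≤ a} hoffmanSpan k) ≥ (1 - ε) log a / (1 + log 2)`: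
the Ball–Rivoal span `ℚ⟨1, ζ(3), …, ζ(a')⟩` is a subspace (`ballRivoalSpan_le_oddWeights`) of this
finite-dimensional space (`finiteDimensional_oddWeights`), `finrank` is monotone
(`Submodule.finrank_mono`), and Ball–Rivoal (`ball_rivoal_holds`, proved in the tree) bounds the
smaller dimension from below. [cite: BallRivoal2001, Théorème 1] -/
theorem stub_oddWeights_finrank_ge :
    ∀ ε : ℝ, 0 < ε → ∀ᶠ a : ℕ in Filter.atTop,
      (1 - ε) * Real.log a / (1 + Real.log 2) ≤
        Module.finrank ℚ ↥(hoffmanSpan 0 ⊔ ⨆ k ∈ (Finset.range (a + 1)).filter Odd, hoffmanSpan k) := by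
  intro ε hε
  filter_upwards [ball_rivoal_holds ε hε] with a ha
  haveI := finiteDimensional_oddWeights a
  exact ha.trans (Nat.cast_le.2 (Submodule.finrank_mono (ballRivoalSpan_le_oddWeights a)))

/-! ## Riders: the dimension tends to infinity; infinitely many odd weights are new -/

/-- **Rider (a)**: `dim_ℚ (hoffmanSpan 0 ⊔ ⨆_{odd k ≤ a} hoffmanSpan k) → ∞` as `a → ∞`
(the stub with `ε = 1/2` and `log a → ∞`). [cite: BallRivoal2001, Théorème 1] -/
theorem oddWeights_finrank_tendsto_atTop :
    Filter.Tendsto (fun a : ℕ => Module.finrank ℚ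
      ↥(hoffmanSpan 0 ⊔ ⨆ k ∈ (Finset.range (a + 1)).filter Odd, hoffmanSpan k))
      Filter.atTop Filter.atTop := by
  rw [← tendsto_natCast_atTop_iff (R := ℝ)]
  have hc : (0 : ℝ) < 1 + Real.log 2 := by
    have := Real.log_pos one_lt_two
    linarith
  have hlog : Tendsto (fun a : ℕ => (1 - 1 / 2 : ℝ) * Real.log a / (1 + Real.log 2))
      atTop atTop :=
    Tendsto.atTop_div_const hc (Tendsto.const_mul_atTop (by norm_num)
      (Real.tendsto_log_atTop.comp tendsto_natCast_atTop_atTop))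
  exact tendsto_atTop_mono' atTop (stub_oddWeights_finrank_ge (1 / 2) (by norm_num)) hlog

/-- **Rider (b)**: infinitely many odd weights contribute NEW dimensions — the set of odd `k` with
`hoffmanSpan k ⊄ hoffmanSpan 0 ⊔ ⨆_{odd j < k} hoffmanSpan j` is infinite. Were it bounded by `K`,
a strong induction on odd `k` would put every `hoffmanSpan k` inside
`W_K = hoffmanSpan 0 ⊔ ⨆_{odd j ≤ K} hoffmanSpan j`, hence every `W_a ≤ W_K` and
`dim_ℚ W_a ≤ dim_ℚ W_K` for all `a`, contradicting `oddWeights_finrank_tendsto_atTop`. It does not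
say WHICH odd weights are new (for two specific odd weights nothing is known).
[cite: BallRivoal2001, Théorème 1] -/
theorem oddWeights_not_le_infinite :
    {k : ℕ | Odd k ∧ ¬ hoffmanSpan k ≤
      hoffmanSpan 0 ⊔ ⨆ j ∈ (Finset.range k).filter Odd, hoffmanSpan j}.Infinite := by
  refine Set.infinite_of_not_bddAbove ?_
  rintro ⟨K, hK⟩
  simp only [mem_upperBounds, Set.mem_setOf_eq, and_imp] at hK
  -- every odd weight span lies in `W_K`
  have key : ∀ k, Odd k → hoffmanSpan k ≤
      hoffmanSpan 0 ⊔ ⨆ j ∈ (Finset.range (K + 1)).filter Odd, hoffmanSpan j := by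
    intro k
    induction k using Nat.strong_induction_on with
    | _ k ih =>
      intro hk
      rcases le_or_gt k K with hkK | hKk
      · have hmem : k ∈ (Finset.range (K + 1)).filter Odd :=
          Finset.mem_filter.2 ⟨Finset.mem_range.2 (Nat.lt_succ_of_le hkK), hk⟩
        exact (le_biSup hoffmanSpan hmem).trans le_sup_right
      · have hle : hoffmanSpan k ≤
            hoffmanSpan 0 ⊔ ⨆ j ∈ (Finset.range k).filter Odd, hoffmanSpan j := by
          by_contra h
          exact absurd (hK k hk h) (not_le.2 hKk)
        refine hle.trans (sup_le le_sup_left (iSup₂_le fun j hj => ?_))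
        exact ih j (Finset.mem_range.1 (Finset.mem_filter.1 hj).1) (Finset.mem_filter.1 hj).2
  -- hence every `W_a ≤ W_K`, and the dimensions are bounded
  have hall : ∀ a : ℕ, hoffmanSpan 0 ⊔ (⨆ k ∈ (Finset.range (a + 1)).filter Odd, hoffmanSpan k) ≤
      hoffmanSpan 0 ⊔ ⨆ j ∈ (Finset.range (K + 1)).filter Odd, hoffmanSpan j := fun a =>
    sup_le le_sup_left (iSup₂_le fun k hk => key k (Finset.mem_filter.1 hk).2)
  haveI := finiteDimensional_oddWeights K
  obtain ⟨a, ha⟩ := (oddWeights_finrank_tendsto_atTop.eventually_ge_atTop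
    (Module.finrank ℚ
      ↥(hoffmanSpan 0 ⊔ ⨆ j ∈ (Finset.range (K + 1)).filter Odd, hoffmanSpan j) + 1)).exists
  exact absurd (ha.trans (Submodule.finrank_mono (hall a))) (Nat.not_succ_le_self _)

end Summit.KontsevichZagierPeriods.LinRedNormalForm.HoffmanIndependence

end
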